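import Mathlib
import Literature.MathematicalPhysics.QuantumFieldTheory.Balaban1983to89.B6QGQFourier275Zd

/-!
# Bałaban [B6] (2.75) p.236 / [B5] (1.65)–(1.66) p.29, scalar, whole lattice `ℤ^d`: (2.75) IN SYMBOL FORM —
# `Σ_{x∈ℤ^d}(Q'G'Q'*)(x,0)cos(p′·x) = (2.75)(p′)` — FOURIER UNIQUENESS on the zone `[−π,π]^d`, and THE SYMBOL OF THE
# COARSE SCALAR ACTION IN CLOSED FORM: `σ(p′) = 1/(2.75)(p′) − a = Δ₀(p′)/X(p′) = [Σ_l|u_j(p′+l)|²/Δ(p′+l)]⁻¹`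

**Source (verbatim; the quotations LOCATE the statements — nothing printed is used as a hypothesis).**
[B6] = T. Bałaban, *Propagators and renormalization transformations for lattice gauge theories. II*, Commun. Math.
Phys. **96** (1984) 223–250 [`Balaban1984PropagatorsII`], p. 236 [PDF 14] (render
`b2b-balaban-ref1/pages/1984-cmp96-propagators-rt-II/…-p014-x2.png`, read as an image by the author of this file;
quoted in full in `B6QGQFourier275Zd`): «In [3] an explicit representation of this operator was found and from this
representation we get the following Fourier representation of Q′_jG′_jQ′_j*:
(Q′_jG′_jQ′_j*)~(p′) = Σ_l |u_j(p′+l)|²Δ₀(p′)/Δ(p′+l) · (a_j Σ_l |u_j(p′+l)|²Δ₀(p′)/Δ(p′+l) + Δ₀(p′))^{−1}, (2.75)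
p′ ∈ [−π, π]^d, l was described in (2.45) [3].»  [B5] = T. Bałaban, *Propagators and renormalization transformations
for lattice gauge theories. I*, Commun. Math. Phys. **95** (1984) 17–40 [`Balaban1984PropagatorsI`], p. 29 (quoted
in `B5Momentum166Zd`): «Using formulas (1.60) or (1.63) we obtain the following expression ⟨B, Δ_kB⟩ = …
|(∂₁B)~_{μν}(p′)|². (1.66)» — the coarse action `Δ_k` of (1.65) as a Fourier multiplier.  The print gives the
multiplier of the VECTOR operator in closed form and ASSERTS (2.75) ("we get"); the scalar multiplier in closed form
is not printed on these pages, and no derivation is.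

**What is proved here (zero `sorry`; every `d`, every block side `n + 1 ≥ 1` (`= L^j`), every `a > 0`).**  Objects,
all from the tree by name: `kerQGQ n a` (= `Q'_jG'_jQ'_j*`, `B6QGQLower276`); its printed multiplier on the real zone
`symbR (n+1) a = X/(aX + Δ₀)`, `X = Σ_k U_kR_k`, `R_0 = 1`, `R_k = Δ₀(p′)/Δ(p′+l_k)` (`B6QGQFourier275Zd` = node g9-2,
literally (2.75): `symbQGQ_eq_printed`); the coarse scalar action `actionKer n a = (Q'G'Q'*)⁻¹ − aδ` of (1.65)
(`B5Hk165ActionZd`, node 8, with `Kinv = (Q'G'Q'*)⁻¹` of `B5Hk103ScalarZd`, node 5), its convolution kernel `kappa`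
and symbol `sigma n a p = Σ'_z κ(z)cos(p·z)` (`B5Ineq167SymbolZd`, g8-2); the zone `BZ d = [−π,π]^d` (`B4ContourShift`).
* §1 [folklore] **`eqOn_zero_of_integral_cexp` — FOURIER UNIQUENESS ON THE BRILLOUIN ZONE**: a function continuous on
  `[−π,π]^d` all of whose character integrals `∫_{[−π,π]^d} h(q)e^{iq·z}dq`, `z ∈ ℤ^d`, vanish is zero on the zone.
  Proof by transport to Mathlib's `UnitAddTorus (Fin d)` — `sect` (the `(−π,π]^d` section of `(ℝ/ℤ)^d`),
  `integral_torus_sect` (`∫_{(ℝ/ℤ)^d} G∘sect = (2π)^{−d}∫_{[−π,π]^d} G`), `mFourier_sect` (the monomials `mFourier n` are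
  the characters `e^{iq·n}`) — and Parseval `UnitAddTorus.hasSum_sq_mFourierCoeff`.
* §2 **(2.75) IN SYMBOL (FOURIER-SERIES) FORM** [cite (2.75) p.236]: the column `x ↦ (Q'G'Q'*)(x,0)` is absolutely
  summable (`summable_abs_kerQGQ_col`), its cosine series `mQ n a p = Σ'_x(Q'G'Q'*)(x,0)cos(p·x)` is continuous, and
  **`mQ_eq_symbR` / `hasSum_kerQGQ_cos`: `Σ_{x∈ℤ^d}(Q'G'Q'*)(x,0)cos(p′·x) = (2.75)(p′)` for `p′ ∈ [−π,π]^d`**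
  (`mQ_eq_printed`: with the printed expression on the right; `hasSum_kerQGQ_row_cos`: any row) — from node g9-2's
  kernel form `kerQGQ_eq_latticeKernel` ((2.75) as an inverse Fourier integral), termwise integration
  (`integral_mQ_mul_cexp`, `integral_symbR_mul_cexp`: both sides have character integrals `(2π)^d(Q'G'Q'*)(z,0)`) and
  §1.  `mQ_bounds`: `2γ₀ ≤ Σ_x(Q'G'Q'*)(x,0)cos(p′·x) ≤ 1/a`.
* §3 **THE SYMBOL OF THE COARSE SCALAR ACTION (1.65) IN CLOSED FORM** [(1.65)–(1.66) p.29 with (2.75) p.236]: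
  `tsum_kappa_mul_kerQGQ` (`Σ_wκ(w)(Q'G'Q'*)(z−w,0) = δ_{z,0} − a(Q'G'Q'*)(z,0)`, i.e. `Δ^{scalar}·Q'G'Q'* = I − aQ'G'Q'*`
  columnwise, from node 5's `(Q'G'Q'*)⁻¹(Q'G'Q'*) = I` and the evenness of the column, node g9-1's `kappa_even`),
  `integral_sigma_symbR_cexp` (termwise integration of the `ℓ¹` series of `σ` against `(2.75)·e^{iq·z}`), hence by §1
  **`sigma_mul_symbR`: `σ(p′)·(2.75)(p′) = 1 − a·(2.75)(p′)`**, **`sigma_eq_inv_symbR_sub`: `σ(p′) = 1/(2.75)(p′) − a`**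
  and **`sigma_eq_closed`: `σ(p′) = Δ₀(p′)/X(p′)`** on the zone (`= [Σ_l|u_j(p′+l)|²/Δ(p′+l)]⁻¹` on reading `R_k`: the
  classical block-averaging multiplier) — manifestly `a`-free, consistent with node 8's `actionKer_indep` (the coarse
  scalar action does not depend on `a`: `⟨B,Δ^{scalar}B⟩` is the Dirichlet energy of the minimal interpolation under the
  constraint `Q'φ = B`, `energy_HB_eq'`), which is not re-derived here.

RELATION TO THE TREE (by name).  `B5Momentum166Zd` (node g9-1), HONEST SCOPE (i): «σ is the symbol of the scalar Δ_k …
as an ℓ¹ trigonometric series, not in closed form» — §3 supplies the closed form; that file's `kappa_eq_integral`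
(symbol ⇒ kernel) and this file's §1 (kernel ⇒ symbol, by uniqueness) are the two directions of Fourier inversion on
the zone.  `B6QGQFourier275Zd` (node g9-2), HONEST SCOPE (ii): «not by summing the series Σ_x(Q'G'Q'*)(x,0)e^{−ip′·x} —
that (Fourier-inversion) form of (2.75) … NOT touched» — §2 is exactly that form.  `B5Ineq167SymbolZd` (g8-2) derived
the multiplier BOUNDS `γ₀ω ≤ σ ≤ γ₁ω` through test fields; here the symbol becomes an explicit rational function of
`U_k = |u_j(p′+l_k)|²` and `Δ(p′+l_k)` (no new bound is derived from it in this file).  The torus files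
(`B5QGGQ145Torus`, `B5Bounds167Lattice`, `Beta/*`) treat different (finite-volume) objects and are not imported.

HONEST SCOPE.  (i) SCALAR, `U = 1`, unit fine lattice, block side `n + 1 = L^j`, `a > 0` free, `m² = 0`; (ii) WHOLE
lattice `ℤ^d`, the zone CLOSED, `[−π,π]^d`, with Lebesgue measure; the identities of §2–§3 are proved ON THE ZONE (off it
`mQ` and `σ` are `2π`-periodic while `symbR` is just the formula — nothing is claimed there); (iii) §1 is the general
folklore tool (continuous on the zone + all character integrals zero ⇒ zero on the zone), obtained from Mathlib's `L²`
theory of `UnitAddTorus`; the measure on `ℝ/ℤ` is fixed by a LOCAL instance to the Haar probability measure exactly as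
in `Mathlib.Analysis.Fourier.AddCircleMulti` (whose results are stated for that instance); (iv) the torus /
finite-volume versions, the vector and covariant operators, (2.74), (2.76)–(2.78) and the (1.66) VECTOR multiplier are
NOT touched; the reading `Δ₀/X = [Σ_l|u_j|²/Δ(p′+l)]⁻¹` is by inspection of `B6QGQFourier275Zd.Rr`, not a separate
theorem; (v) nothing here is summit progress: value = kernel discharge of one printed representation in its second
(series) form and the closed form of one symbol, scalar infinite-volume setting.

ABSOLUTE-RULE CENSUS: every theorem below is proved outright from the tree modules named above and Mathlib
(sorry-free; axioms `propext`, `Classical.choice`, `Quot.sound` only); no quoted statement is used as a hypothesis;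
the hypotheses of the headline theorems are `0 < a` and `p′ ∈ [−π,π]^d` only.  Unit `b2b-balaban-pv23-g9` (surge node
prover #23, gen 9; journal claim B6-275-QGQ-SYMBOL-SERIES-ZD); value = kernel discharge (scalar, infinite volume), NOT
summit progress.
-/

namespace Literature.MathematicalPhysics.QuantumFieldTheory.Balaban1983to89.B6QGQSymbol275Zd

open MeasureTheory Complex Set
open B6QGQLower276 (X kerQGQ kerQGQ_symm abs_kerQGQ_le cQ deltaQ cQ_pos deltaQ_pos)
open B4ContourShift (BZ)
open B5Momentum166Zd (BZ_eq_pi isCompact_BZ measurableSet_BZ phaseC_eq)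
open scoped Real Pointwise

noncomputable section

variable {d : ℕ}

/-- As in `Mathlib.Analysis.Fourier.AddCircleMulti` (and `QuantumManyBody/PeriodicBoseGasFourier`), the measure on `ℝ/ℤ` is the
Haar probability measure (Mathlib's global instance is `ENNReal.ofReal 1 • haarAddCircle`, equal but not definitionally; the results
of that file are stated for this instance). [folklore] -/
local instance : MeasureSpace UnitAddCircle := ⟨AddCircle.haarAddCircle⟩

/-- The measure on `ℝ/ℤ` is a probability measure. [folklore] -/
local instance : IsProbabilityMeasure (volume : Measure UnitAddCircle) :=
  inferInstanceAs (IsProbabilityMeasure AddCircle.haarAddCircle)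

/-- The measure on `(ℝ/ℤ)^d` is a probability measure. [folklore] -/
local instance : IsProbabilityMeasure (volume : Measure (UnitAddTorus (Fin d))) := by
  rw [volume_pi]; infer_instance

/-! ## §1  Fourier uniqueness on the Brillouin zone [folklore] -/

/-- the representative of a point of the unit torus `(ℝ/ℤ)^d` in the box `(-1/2, 1/2]^d`, scaled by `2π`: a point of
`(-π, π]^d ⊂ [-π, π]^d`. [folklore] -/
def sect (t : UnitAddTorus (Fin d)) : Fin d → ℝ :=
  fun i => 2 * π * ((AddCircle.equivIoc 1 (-(1 / 2 : ℝ)) (t i) : ℝ))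

/-- the half-open unit box `(-1/2, 1/2]^d`. [folklore] -/
def boxHalf (d : ℕ) : Set (Fin d → ℝ) := {x | ∀ i, x i ∈ Ioc (-(1 / 2 : ℝ)) (-(1 / 2 : ℝ) + 1)}

/-- the half-open zone `(-π, π]^d`. [folklore] -/
def boxPi (d : ℕ) : Set (Fin d → ℝ) := {q | ∀ i, q i ∈ Ioc (-π) π}

/-- each coordinate of the scaled representative lies in `(-π, π]`. [folklore] -/
theorem sect_mem (t : UnitAddTorus (Fin d)) (i : Fin d) : sect t i ∈ Ioc (-π) π := by
  have h := (AddCircle.equivIoc 1 (-(1 / 2 : ℝ)) (t i)).2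
  simp only [mem_Ioc] at h
  simp only [sect, mem_Ioc]
  constructor <;> nlinarith [h.1, h.2, Real.pi_pos]

/-- the scaled representative lies in the Brillouin zone. [folklore] -/
theorem sect_mem_BZ (t : UnitAddTorus (Fin d)) : sect t ∈ BZ d := by
  rw [BZ_eq_pi]
  exact fun i _ => ⟨(sect_mem t i).1.le, (sect_mem t i).2⟩

/-- on the half box, `sect ∘ (mod ℤ^d)` is multiplication by `2π`. [folklore] -/
theorem sect_coe {x : Fin d → ℝ} (hx : x ∈ boxHalf d) :
    sect (fun i => ((x i : ℝ) : UnitAddCircle)) = (2 * π) • x := by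
  funext i
  have h := AddCircle.equivIoc_coe_of_mem (p := (1 : ℝ)) (a := -(1 / 2 : ℝ)) (y := x i) (hx i)
  simp only [sect, Pi.smul_apply, smul_eq_mul]
  rw [h]

/-- `(mod ℤ^d) ∘ ((2π)⁻¹ • sect) = id`. [folklore] -/
theorem coe_sect (t : UnitAddTorus (Fin d)) (i : Fin d) :
    ((((2 * π)⁻¹ * sect t i : ℝ)) : UnitAddCircle) = t i := by
  simp only [sect]
  rw [← mul_assoc, inv_mul_cancel₀ (by positivity : (2 * π : ℝ) ≠ 0), one_mul, AddCircle.coe_equivIoc]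

/-- `sect` is measurable. [folklore] -/
theorem measurable_sect : Measurable (sect (d := d)) := by
  refine measurable_pi_lambda _ fun i => measurable_const.mul ?_
  exact (measurable_subtype_coe.comp (AddCircle.measurableEquivIoc 1 (-(1 / 2 : ℝ))).measurable).comp
    (measurable_pi_apply i)

/-- `2π • (-1/2, 1/2]^d = (-π, π]^d`. [folklore] -/
theorem smul_boxHalf : (2 * π) • boxHalf d = boxPi d := by
  ext q
  rw [Set.mem_smul_set_iff_inv_smul_mem₀ (by positivity : (2 * π : ℝ) ≠ 0)]
  simp only [boxHalf, boxPi, mem_setOf_eq, Pi.smul_apply, smul_eq_mul, mem_Ioc]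
  refine forall_congr' fun i => ?_
  have hπ : 0 < 2 * π := by positivity
  rw [inv_mul_eq_div, lt_div_iff₀ hπ, div_le_iff₀ hπ]
  constructor <;> rintro ⟨h1, h2⟩ <;> constructor <;> linarith

/-- `(-π, π]^d` and `[-π, π]^d` agree up to a null set. [folklore] -/
theorem boxPi_ae_eq_BZ : boxPi d =ᵐ[volume] BZ d := by
  have h1 : boxPi d = Set.univ.pi fun _ : Fin d => Ioc (-π) π := by ext q; simp [boxPi]
  rw [h1, BZ_eq_pi, volume_pi]
  exact Measure.pi_Ioc_ae_eq_pi_Icc (μ := fun _ : Fin d => (volume : Measure ℝ))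

/-- **Integration over the torus through the zone**: `∫_{(ℝ/ℤ)^d} G(sect t) dt = (2π)^{-d} ∫_{[-π,π]^d} G(q) dq`.
[folklore] -/
theorem integral_torus_sect {E : Type*} [NormedAddCommGroup E] [NormedSpace ℝ E] (G : (Fin d → ℝ) → E) :
    ∫ t : UnitAddTorus (Fin d), G (sect t) = (((2 * π) ^ d)⁻¹ : ℝ) • ∫ q in BZ d, G q := by
  rw [UnitAddTorus.integral_preimage (fun t => G (sect t)) (fun _ => -(1 / 2 : ℝ))]
  have hB : {x : Fin d → ℝ | ∀ i, x i ∈ Ioc ((fun _ : Fin d => -(1 / 2 : ℝ)) i) ((fun _ : Fin d => -(1 / 2 : ℝ)) i + 1)}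
      = boxHalf d := rfl
  rw [hB]
  have hS : MeasurableSet (boxHalf d) := by
    have : boxHalf d = ⋂ i : Fin d, (fun x : Fin d → ℝ => x i) ⁻¹' Ioc (-(1 / 2 : ℝ)) (-(1 / 2 : ℝ) + 1) := by
      ext x; simp [boxHalf]
    rw [this]
    exact MeasurableSet.iInter fun i => measurableSet_Ioc.preimage (measurable_pi_apply i)
  have hcongr : ∀ x ∈ boxHalf d, G (sect (fun i => ((x i : ℝ) : UnitAddCircle))) = (fun y => G ((2 * π) • y)) x :=
    fun x hx => by simp only [sect_coe hx]
  rw [setIntegral_congr_fun hS hcongr, Measure.setIntegral_comp_smul_of_pos volume G _ (by positivity : (0 : ℝ) < 2 * π),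
    smul_boxHalf, Module.finrank_fin_fun, setIntegral_congr_set boxPi_ae_eq_BZ]

/-- the Fourier monomial `e_n` of the unit torus at `x mod ℤ^d` is the character `e^{i n·q}` at the momentum `q = 2πx`. [folklore] -/
theorem mFourier_coe (n : Fin d → ℤ) (x : Fin d → ℝ) :
    UnitAddTorus.mFourier n (fun i => ((x i : ℝ) : UnitAddCircle)) = cexp (I * B4ContourShift.phase ((2 * π) • x) n) := by
  unfold UnitAddTorus.mFourier B4ContourShift.phase
  simp only [ContinuousMap.coe_mk, fourier_coe_apply, Pi.smul_apply, smul_eq_mul]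
  rw [← Complex.exp_sum, Finset.mul_sum]
  congr 1
  refine Finset.sum_congr rfl fun i _ => ?_
  push_cast
  ring

/-- the Fourier monomial `e_n` at a torus point `t` is the character `e^{i n·q}` at the zone point `q = sect t`. [folklore] -/
theorem mFourier_sect (n : Fin d → ℤ) (t : UnitAddTorus (Fin d)) :
    UnitAddTorus.mFourier n t = cexp (I * B4ContourShift.phase (sect t) n) := by
  have ht : t = fun i => ((((2 * π)⁻¹ * sect t i : ℝ)) : UnitAddCircle) := funext fun i => (coe_sect t i).symm
  have hs : (2 * π) • (fun i => (2 * π)⁻¹ * sect t i) = sect t := by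
    funext i
    simp only [Pi.smul_apply, smul_eq_mul]
    rw [← mul_assoc, mul_inv_cancel₀ (by positivity : (2 * π : ℝ) ≠ 0), one_mul]
  conv_lhs => rw [ht]
  rw [mFourier_coe, hs]

/-- `[-π, π]^d` is the closure of its interior. [folklore] -/
theorem BZ_subset_closure_interior : BZ d ⊆ closure (interior (BZ d)) := by
  rw [BZ_eq_pi, interior_pi_set Set.finite_univ, closure_pi_set]
  refine Set.pi_mono fun i _ => ?_
  rw [interior_Icc, closure_Ioo (by linarith [Real.pi_pos] : (-π : ℝ) ≠ π)]

/-- **FOURIER UNIQUENESS ON THE BRILLOUIN ZONE.** A function continuous on `[-π, π]^d` all of whose character integrals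
`∫_{[-π,π]^d} h(q) e^{i q·z} dq`, `z ∈ ℤ^d`, vanish is identically zero on the zone. (Transport to the unit torus
`(ℝ/ℤ)^d`, Parseval for `L²((ℝ/ℤ)^d)` — Mathlib's `UnitAddTorus.hasSum_sq_mFourierCoeff` — and continuity.) [folklore] -/
theorem eqOn_zero_of_integral_cexp {h : (Fin d → ℝ) → ℂ} (hc : ContinuousOn h (BZ d))
    (hz : ∀ z : X d, ∫ q in BZ d, h q * cexp (I * B4ContourShift.phase q z) = 0) : EqOn h 0 (BZ d) := by
  -- the transported function on the torus
  have hmeas : Measurable fun t : UnitAddTorus (Fin d) => h (sect t) := by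
    have h1 : (fun t : UnitAddTorus (Fin d) => h (sect t)) = (BZ d).restrict h ∘ fun t => (⟨sect t, sect_mem_BZ t⟩ : BZ d) := rfl
    rw [h1]
    exact (continuousOn_iff_continuous_restrict.1 hc).measurable.comp measurable_sect.subtype_mk
  obtain ⟨C, hC⟩ := isCompact_BZ.exists_bound_of_continuousOn hc
  have hLp : MemLp (fun t : UnitAddTorus (Fin d) => h (sect t)) 2 volume :=
    MemLp.of_bound hmeas.aestronglyMeasurable C (Filter.Eventually.of_forall fun t => hC _ (sect_mem_BZ t))
  -- all Fourier coefficients of the transported function vanish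
  have hcoef : ∀ n, UnitAddTorus.mFourierCoeff (fun t : UnitAddTorus (Fin d) => h (sect t)) n = 0 := by
    intro n
    unfold UnitAddTorus.mFourierCoeff
    have h1 : ∀ t : UnitAddTorus (Fin d), UnitAddTorus.mFourier (-n) t • h (sect t)
        = (fun q => h q * cexp (I * B4ContourShift.phase q (-n))) (sect t) := by
      intro t; rw [mFourier_sect, smul_eq_mul, mul_comm]
    simp_rw [h1]
    have h2 := integral_torus_sect (d := d) (fun q => h q * cexp (I * B4ContourShift.phase q (-n)))
    rw [hz (-n), smul_zero] at h2
    exact h2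
  -- Parseval: the transported function has zero `L²` norm
  have hP := UnitAddTorus.hasSum_sq_mFourierCoeff (hLp.toLp _)
  have hcoef' : ∀ n, UnitAddTorus.mFourierCoeff (hLp.toLp _ : UnitAddTorus (Fin d) → ℂ) n = 0 := fun n => by
    rw [← hcoef n]; exact integral_congr_ae (hLp.coeFn_toLp.mono fun t ht => by simp only [ht])
  have hnorm : ∫ t, ‖(hLp.toLp _ : UnitAddTorus (Fin d) → ℂ) t‖ ^ 2 = ∫ t : UnitAddTorus (Fin d), ‖h (sect t)‖ ^ 2 :=
    integral_congr_ae (hLp.coeFn_toLp.mono fun t ht => by simp only [ht])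
  simp only [hcoef', norm_zero, ne_eq, OfNat.ofNat_ne_zero, not_false_eq_true, zero_pow, hnorm] at hP
  have h0 : (((2 * π) ^ d)⁻¹ : ℝ) • ∫ q in BZ d, ‖h q‖ ^ 2 = 0 := by
    rw [← integral_torus_sect (fun q => ‖h q‖ ^ 2)]
    exact hP.unique hasSum_zero
  have h2 : ∫ q in BZ d, ‖h q‖ ^ 2 = 0 := (smul_eq_zero.1 h0).resolve_left (by positivity)
  -- hence `‖h‖² = 0` a.e. on the zone, and everywhere by continuity
  have hint : IntegrableOn (fun q => ‖h q‖ ^ 2) (BZ d) := (hc.norm.pow 2).integrableOn_compact isCompact_BZ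
  have hae : (fun q => ‖h q‖ ^ 2) =ᵐ[volume.restrict (BZ d)] 0 :=
    (setIntegral_eq_zero_iff_of_nonneg_ae (Filter.Eventually.of_forall fun q => by simp only [Pi.zero_apply]; positivity)
      hint).1 h2
  have hEq := Measure.eqOn_of_ae_eq hae (hc.norm.pow 2) continuousOn_const BZ_subset_closure_interior
  intro q hq
  have := hEq hq
  simp only [Pi.zero_apply, ne_eq, OfNat.ofNat_ne_zero, not_false_eq_true, pow_eq_zero_iff, norm_eq_zero] at this
  simpa using this

/-! ## §2  The symbol series of `Q'G'Q'*`: B6 (2.75) in symbol form [cite: Balaban1984PropagatorsII, (2.75) p.236] -/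

section QGQ

open B5Ineq167SymbolZd (phase phase_add phase_sub)
open B5Momentum166Zd (continuous_cos_phase integrableOn_BZ integrableOn_BZ' volume_real_BZ)
open B5Hk103ScalarZd (summable_expX)
open B6QGQFourier275Zd (symbR symbQGQ symbQGQ_ofReal symbQGQ_eq_printed continuousOn_symbR continuous_cexp_phase
  kerQGQ_eq_latticeKernel twoGamma0 symbR_ge symbR_le)
open B4Strip (ofRealVec)
open B4ContourShift (latticeKernel fourierBox integrand norm_cexp_phase)
open B4Green244 (fourierBox_one)

/-- the column `x ↦ (Q'G'Q'*)(x, 0)` is absolutely summable over `ℤ^d` (exponential decay, `B6QGQLower276.abs_kerQGQ_le`).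
[folklore] -/
theorem summable_abs_kerQGQ_col (n : ℕ) {a : ℝ} (ha : 0 < a) : Summable fun x : X d => |kerQGQ n a x 0| := by
  refine Summable.of_nonneg_of_le (fun _ => abs_nonneg _) (fun x => abs_kerQGQ_le n ha x 0) ?_
  refine ((summable_expX (deltaQ_pos (d := d) n ha) (0 : X d)).mul_left (cQ d n a)).congr fun x => ?_
  rw [dist_comm]

/-- **(Q'G'Q'*)(-x, 0) = (Q'G'Q'*)(x, 0)**: the column is even (symmetry and translation invariance of the kernel).
[folklore] -/
theorem kerQGQ_neg_col (n : ℕ) {a : ℝ} (ha : 0 < a) (x : X d) : kerQGQ n a (-x) 0 = kerQGQ n a x 0 := by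
  have h1 := kerQGQ_eq_latticeKernel n ha (-x) 0
  have h2 := kerQGQ_eq_latticeKernel n ha 0 x
  rw [sub_zero] at h1
  rw [zero_sub] at h2
  have h3 : (kerQGQ n a (-x) 0 : ℂ) = kerQGQ n a 0 x := by rw [h1, h2]
  rw [kerQGQ_symm n ha 0 x] at h3
  exact_mod_cast h3

/-- `(Q'G'Q'*)(y, y') = (Q'G'Q'*)(y - y', 0)` (translation invariance). [folklore] -/
theorem kerQGQ_eq_col (n : ℕ) {a : ℝ} (ha : 0 < a) (y y' : X d) : kerQGQ n a y y' = kerQGQ n a (y - y') 0 := by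
  have h1 := kerQGQ_eq_latticeKernel n ha y y'
  have h2 := kerQGQ_eq_latticeKernel n ha (y - y') 0
  rw [sub_zero] at h2
  exact_mod_cast h1.trans h2.symm

/-- **The symbol series of `Q'G'Q'*`**: `m_Q(p) = Σ_{x ∈ ℤ^d} (Q'G'Q'*)(x, 0) cos(p·x)`, the Fourier (cosine) series of the
even, absolutely summable column of the pv23 operator `B6QGQLower276.kerQGQ`. [folklore] -/
def mQ (n : ℕ) (a : ℝ) (p : Fin d → ℝ) : ℝ := ∑' x : X d, kerQGQ n a x 0 * Real.cos (phase p x)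

/-- the terms of the symbol series are dominated by the summable column. [folklore] -/
theorem abs_mQ_term_le (n : ℕ) (a : ℝ) (p : Fin d → ℝ) (x : X d) :
    |kerQGQ n a x 0 * Real.cos (phase p x)| ≤ |kerQGQ n a x 0| := by
  rw [abs_mul]
  exact mul_le_of_le_one_right (abs_nonneg _) (Real.abs_cos_le_one _)

/-- the symbol series converges absolutely. [folklore] -/
theorem summable_mQ_term (n : ℕ) {a : ℝ} (ha : 0 < a) (p : Fin d → ℝ) :
    Summable fun x : X d => kerQGQ n a x 0 * Real.cos (phase p x) :=
  (Summable.of_nonneg_of_le (fun _ => abs_nonneg _) (abs_mQ_term_le n a p) (summable_abs_kerQGQ_col n ha)).of_abs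

/-- `m_Q` is continuous on `ℝ^d` (uniformly convergent series). [folklore] -/
theorem continuous_mQ (n : ℕ) {a : ℝ} (ha : 0 < a) : Continuous (mQ (d := d) n a) := by
  unfold mQ
  refine continuous_tsum (fun x => ?_) (summable_abs_kerQGQ_col n ha) (fun x p => ?_)
  · exact continuous_const.mul (continuous_cos_phase x)
  · rw [Real.norm_eq_abs]; exact abs_mQ_term_le n a p x

/-- `cos θ · e^{iφ} = ½ (e^{i(θ+φ)} + e^{i(φ-θ)})`. [folklore] -/
theorem ofReal_cos_mul_cexp (θ φ : ℝ) :
    (Real.cos θ : ℂ) * cexp (I * φ) = (1 / 2 : ℂ) * (cexp (I * ((θ + φ : ℝ) : ℂ)) + cexp (I * ((φ - θ : ℝ) : ℂ))) := by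
  have e1 : cexp (I * ((θ + φ : ℝ) : ℂ)) = cexp (θ * I) * cexp (I * φ) := by
    rw [← Complex.exp_add]; congr 1; push_cast; ring
  have e2 : cexp (I * ((φ - θ : ℝ) : ℂ)) = cexp (-θ * I) * cexp (I * φ) := by
    rw [← Complex.exp_add]; congr 1; push_cast; ring
  rw [e1, e2, Complex.ofReal_cos, Complex.cos]
  ring

/-- **`∫_{[-π,π]^d} cos(q·x) e^{i q·z} dq = ½ (2π)^d (δ_{x+z,0} + δ_{z-x,0})`** (`x, z ∈ ℤ^d`). [folklore] -/
theorem integral_cos_mul_cexp (x z : X d) :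
    ∫ q in BZ d, (Real.cos (phase q x) : ℂ) * cexp (I * B4ContourShift.phase q z)
      = (2 * π : ℂ) ^ d / 2 * ((if x + z = 0 then 1 else 0) + (if z - x = 0 then 1 else 0)) := by
  have hF : ∀ w : X d, ∫ q in BZ d, cexp (I * B4ContourShift.phase q w) = if w = 0 then (2 * π : ℂ) ^ d else 0 := by
    intro w
    have h := fourierBox_one (d := d) w
    unfold fourierBox integrand at h
    simpa only [one_mul] using h
  have hpt : ∀ q : Fin d → ℝ, (Real.cos (phase q x) : ℂ) * cexp (I * B4ContourShift.phase q z)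
      = (1 / 2 : ℂ) * (cexp (I * B4ContourShift.phase q (x + z)) + cexp (I * B4ContourShift.phase q (z - x))) := by
    intro q
    rw [phaseC_eq, phaseC_eq, phaseC_eq, phase_add, phase_sub, ofReal_cos_mul_cexp]
  simp_rw [hpt]
  rw [integral_const_mul, integral_add (integrableOn_BZ' (continuous_cexp_phase (x + z)))
    (integrableOn_BZ' (continuous_cexp_phase (z - x))), hF, hF]
  split_ifs <;> ring

/-- **The character integrals of the symbol series**: `∫_{[-π,π]^d} m_Q(q) e^{i q·z} dq = (2π)^d (Q'G'Q'*)(z, 0)` (termwise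
integration of the absolutely convergent series, orthogonality of the characters, evenness of the column). [folklore] -/
theorem integral_mQ_mul_cexp (n : ℕ) {a : ℝ} (ha : 0 < a) (z : X d) :
    ∫ q in BZ d, (mQ n a q : ℂ) * cexp (I * B4ContourShift.phase q z) = (2 * π : ℂ) ^ d * kerQGQ n a z 0 := by
  set F : X d → (Fin d → ℝ) → ℂ := fun x q => (kerQGQ n a x 0 : ℂ) * ((Real.cos (phase q x) : ℂ) * cexp (I * B4ContourShift.phase q z))
    with hF_def
  have hterm : ∀ q : Fin d → ℝ, (mQ n a q : ℂ) * cexp (I * B4ContourShift.phase q z) = ∑' x : X d, F x q := by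
    intro q
    unfold mQ
    rw [Complex.ofReal_tsum, ← tsum_mul_right]
    refine tsum_congr fun x => ?_
    simp only [hF_def]
    push_cast
    ring
  have hint : ∀ x : X d, Integrable (F x) (volume.restrict (BZ d)) := fun x =>
    integrableOn_BZ' (continuous_const.mul ((Complex.continuous_ofReal.comp (continuous_cos_phase x)).mul
      (continuous_cexp_phase z)))
  have hnorm : ∀ x (q : Fin d → ℝ), ‖F x q‖ ≤ |kerQGQ n a x 0| := by
    intro x q
    simp only [hF_def, norm_mul, Complex.norm_real, Real.norm_eq_abs, norm_cexp_phase, mul_one]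
    exact mul_le_of_le_one_right (abs_nonneg _) (Real.abs_cos_le_one _)
  have hsum : Summable fun x : X d => ∫ q in BZ d, ‖F x q‖ := by
    refine Summable.of_nonneg_of_le (fun x => integral_nonneg fun q => norm_nonneg _) (fun x => ?_)
      ((summable_abs_kerQGQ_col n ha).mul_right ((2 * π) ^ d))
    have hmono : ∫ q in BZ d, ‖F x q‖ ≤ ∫ q in BZ d, |kerQGQ n a x 0| :=
      setIntegral_mono_on (hint x).norm (integrableOn_BZ continuous_const) measurableSet_BZ fun q _ => hnorm x q
    rw [setIntegral_const, volume_real_BZ, smul_eq_mul] at hmono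
    linarith
  simp_rw [hterm]
  rw [← integral_tsum_of_summable_integral_norm hint hsum]
  simp only [hF_def]
  simp_rw [integral_const_mul, integral_cos_mul_cexp]
  have e1 : ∀ x : X d, x + z = 0 ↔ x = -z := fun x => add_eq_zero_iff_eq_neg
  have e2 : ∀ x : X d, z - x = 0 ↔ x = z := fun x => sub_eq_zero.trans eq_comm
  have h1 : ∀ x : X d, (kerQGQ n a x 0 : ℂ) * ((2 * π : ℂ) ^ d / 2 * ((if x + z = 0 then 1 else 0) + (if z - x = 0 then 1 else 0)))
      = (2 * π : ℂ) ^ d / 2 * (kerQGQ n a z 0 : ℂ) * ((if x = -z then 1 else 0) + (if x = z then 1 else 0)) := by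
    intro x
    simp only [e1, e2]
    by_cases hx : x = -z
    · have hk : kerQGQ n a x 0 = kerQGQ n a z 0 := by rw [hx, kerQGQ_neg_col n ha]
      rw [hk]
      ring
    · rw [if_neg hx]
      by_cases hx' : x = z
      · subst hx'
        ring
      · rw [if_neg hx']
        ring
  rw [tsum_congr h1, tsum_mul_left, Summable.tsum_add (hasSum_ite_eq _ _).summable (hasSum_ite_eq _ _).summable,
    (hasSum_ite_eq (-z) (1 : ℂ)).tsum_eq, (hasSum_ite_eq z (1 : ℂ)).tsum_eq]
  ring

/-- **The character integrals of the printed multiplier**: `∫_{[-π,π]^d} symbR(q) e^{i q·z} dq = (2π)^d (Q'G'Q'*)(z, 0)` — node 2's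
kernel formula `B6QGQFourier275Zd.kerQGQ_eq_latticeKernel` ((2.75) as an inverse Fourier integral) read backwards. [folklore] -/
theorem integral_symbR_mul_cexp (n : ℕ) {a : ℝ} (ha : 0 < a) (z : X d) :
    ∫ q in BZ d, (symbR (n + 1) a q : ℂ) * cexp (I * B4ContourShift.phase q z) = (2 * π : ℂ) ^ d * kerQGQ n a z 0 := by
  have h := kerQGQ_eq_latticeKernel n ha z 0
  rw [sub_zero] at h
  unfold latticeKernel fourierBox integrand at h
  simp_rw [symbQGQ_ofReal] at h
  rw [h, Complex.real_smul]
  push_cast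
  have hne : (2 * π : ℂ) ^ d ≠ 0 := pow_ne_zero _ (mul_ne_zero two_ne_zero (Complex.ofReal_ne_zero.2 Real.pi_ne_zero))
  rw [← mul_assoc, mul_inv_cancel₀ hne, one_mul]

/-- **B6 (2.75) IN SYMBOL FORM — the Fourier series of the `Q'G'Q'*` column sums to the printed multiplier on the zone**:
`Σ_{x ∈ ℤ^d} (Q'G'Q'*)(x, 0) cos(p·x) = symbR(p) = X(p)/(aX(p) + Δ₀(p))`, `X = Σ_k U_k R_k`, for `p ∈ [-π, π]^d`
(both sides are continuous on the zone and have the same character integrals `(2π)^d (Q'G'Q'*)(z,0)`; Fourier uniqueness §1).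
[cite: Balaban1984PropagatorsII, (2.75) p.236] -/
theorem mQ_eq_symbR (n : ℕ) {a : ℝ} (ha : 0 < a) {p : Fin d → ℝ} (hp : p ∈ BZ d) : mQ n a p = symbR (n + 1) a p := by
  have hN : 1 ≤ n + 1 := by omega
  have hcs : ContinuousOn (fun q : Fin d → ℝ => (symbR (n + 1) a q : ℂ)) (BZ d) :=
    Complex.continuous_ofReal.comp_continuousOn (continuousOn_symbR (n + 1) hN ha)
  have hcm : Continuous fun q : Fin d → ℝ => (mQ n a q : ℂ) := Complex.continuous_ofReal.comp (continuous_mQ n ha)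
  have h := eqOn_zero_of_integral_cexp (d := d) (h := fun q => (mQ n a q : ℂ) - (symbR (n + 1) a q : ℂ))
    (hcm.continuousOn.sub hcs) ?_ hp
  · simpa [sub_eq_zero] using h
  · intro z
    have hi1 : IntegrableOn (fun q : Fin d → ℝ => (mQ n a q : ℂ) * cexp (I * B4ContourShift.phase q z)) (BZ d) :=
      integrableOn_BZ' (hcm.mul (continuous_cexp_phase z))
    have hi2 : IntegrableOn (fun q : Fin d → ℝ => (symbR (n + 1) a q : ℂ) * cexp (I * B4ContourShift.phase q z)) (BZ d) :=
      (hcs.mul (continuous_cexp_phase z).continuousOn).integrableOn_compact isCompact_BZ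
    simp_rw [sub_mul]
    rw [integral_sub hi1 hi2, integral_mQ_mul_cexp n ha, integral_symbR_mul_cexp n ha, sub_self]

/-- **(2.75), `HasSum` form**: `Σ_{x ∈ ℤ^d} (Q'G'Q'*)(x,0) cos(p·x)` converges (absolutely) to the printed multiplier `symbR(p)`,
`p ∈ [-π,π]^d`. [cite: Balaban1984PropagatorsII, (2.75) p.236] -/
theorem hasSum_kerQGQ_cos (n : ℕ) {a : ℝ} (ha : 0 < a) {p : Fin d → ℝ} (hp : p ∈ BZ d) :
    HasSum (fun x : X d => kerQGQ n a x 0 * Real.cos (phase p x)) (symbR (n + 1) a p) := by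
  rw [← mQ_eq_symbR n ha hp]
  exact (summable_mQ_term n ha p).hasSum

/-- **(2.75), printed form on the zone**: `Σ_{x} (Q'G'Q'*)(x,0) cos(p·x) = (Σ_k U_k(p)R_k(p)) · (a Σ_k U_k(p)R_k(p) + Δ(p'))⁻¹` with the
complex-momentum blocks `U, R = B4StripSums.R, DeltaXi` of `B4Strip`/`B4Green244` at the real momentum `p`
(`B6QGQFourier275Zd.symbQGQ_eq_printed`). [cite: Balaban1984PropagatorsII, (2.75) p.236] -/
theorem mQ_eq_printed (n : ℕ) {a : ℝ} (ha : 0 < a) {p : Fin d → ℝ} (hp : p ∈ BZ d) :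
    ((mQ n a p : ℝ) : ℂ) = (∑ k : Fin d → Fin (n + 1), B4Strip.U (n + 1) k (ofRealVec p) * B4StripSums.R (n + 1) 0 k (ofRealVec p))
      * ((a : ℂ) * ∑ k : Fin d → Fin (n + 1), B4Strip.U (n + 1) k (ofRealVec p) * B4StripSums.R (n + 1) 0 k (ofRealVec p)
        + B4Strip.DeltaXi (n + 1) 0 (ofRealVec p))⁻¹ := by
  rw [mQ_eq_symbR n ha hp, ← symbQGQ_ofReal, symbQGQ_eq_printed]

/-- **the symbol of `Q'G'Q'*` obeys the printed (2.50)/(2.76) bounds**: `2γ₀ ≤ Σ_x (Q'G'Q'*)(x,0)cos(p·x) ≤ 1/a` on the zone, with the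
explicit `2γ₀ = (4/π²)^d / (a(4/π²)^d + dπ²)` of node 2. [cite: Balaban1984PropagatorsII, (2.76) p.236] -/
theorem mQ_bounds (n : ℕ) {a : ℝ} (ha : 0 < a) {p : Fin d → ℝ} (hp : p ∈ BZ d) :
    twoGamma0 d a ≤ mQ n a p ∧ mQ n a p ≤ 1 / a := by
  rw [mQ_eq_symbR n ha hp]
  exact ⟨symbR_ge (n + 1) (by omega) ha p hp, symbR_le (n + 1) ha p⟩

/-- **row version**: for every coarse point `y`, `Σ_{y'} (Q'G'Q'*)(y, y') cos(p·(y - y')) = symbR(p)` on the zone (translation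
invariance `kerQGQ_eq_col`). [cite: Balaban1984PropagatorsII, (2.75) p.236] -/
theorem hasSum_kerQGQ_row_cos (n : ℕ) {a : ℝ} (ha : 0 < a) {p : Fin d → ℝ} (hp : p ∈ BZ d) (y : X d) :
    HasSum (fun y' : X d => kerQGQ n a y y' * Real.cos (phase p (y - y'))) (symbR (n + 1) a p) := by
  have h := (Equiv.hasSum_iff (Equiv.subLeft y)).2 (hasSum_kerQGQ_cos n ha hp)
  convert h using 1
  funext y'
  simp only [Function.comp_apply, Equiv.subLeft_apply, kerQGQ_eq_col n ha y y']

end QGQ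

/-! ## §3  The symbol of the coarse scalar action in closed form: `σ = 1/symbR − a = Δ₀/X` [B5 (1.66) p.29, scalar] -/

section Sigma

open B5Ineq167SymbolZd (phase phase_add phase_sub sigma kappa summable_abs_kappa continuous_sigma)
open B5Momentum166Zd (continuous_cos_phase integrableOn_BZ integrableOn_BZ' volume_real_BZ kappa_even)
open B5Hk165ActionZd (actionKer)
open B5Hk103ScalarZd (Kinv tsum_Kinv_mul_kerQGQ)
open B5Hk165TranslZd (Kinv_eq_col_zero)
open B6QGQFourier275Zd (symbR symbQGQ symbQGQ_ofReal continuousOn_symbR continuous_cexp_phase kerQGQ_eq_latticeKernel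
  twoGamma0 twoGamma0_pos symbR_ge symbR_le Xr Xr_ge Rr Er_eq)
open B4Strip (ofRealVec DeltaXir DeltaXir_nonneg)
open B4ContourShift (latticeKernel fourierBox integrand norm_cexp_phase)
open B4Green244 (fourierBox_one)

/-- the column `w ↦ (Q'G'Q'*)⁻¹(w, 0)` is even (`kappa_even`). [folklore] -/
theorem Kinv_col_even (n : ℕ) {a : ℝ} (ha : 0 < a) (w : X d) : Kinv n a (-w) 0 = Kinv n a w 0 := by
  have h := kappa_even n ha w
  unfold kappa actionKer at h
  simp only [neg_eq_zero] at h
  linarith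

/-- `Σ_w (Q'G'Q'*)⁻¹(w, 0) (Q'G'Q'*)(w, z) = δ_{z,0}` (the tree's `(Q'G'Q'*)⁻¹(Q'G'Q'*) = I`, node 5 `B5Hk103ScalarZd`, through the evenness
of the column, node g9-1). [folklore] -/
theorem tsum_Kinv_col_mul_kerQGQ (n : ℕ) {a : ℝ} (ha : 0 < a) (z : X d) :
    ∑' w : X d, Kinv n a w 0 * kerQGQ n a w z = if z = 0 then 1 else 0 := by
  have h := tsum_Kinv_mul_kerQGQ n ha 0 z
  have hw : ∀ w : X d, Kinv n a 0 w = Kinv n a w 0 := fun w => by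
    rw [Kinv_eq_col_zero n ha 0 w, zero_sub, Kinv_col_even n ha]
  simp_rw [hw] at h
  rw [h]
  by_cases hz : z = 0 <;> simp [hz, eq_comm]

/-- `|(Q'G'Q'*)(y, y')| ≤ c_Q`. [folklore] -/
theorem abs_kerQGQ_le_cQ (n : ℕ) {a : ℝ} (ha : 0 < a) (y y' : X d) : |kerQGQ n a y y'| ≤ cQ d n a :=
  (abs_kerQGQ_le n ha y y').trans (mul_le_of_le_one_right (cQ_pos n ha).le
    (Real.exp_le_one_iff.2 (neg_nonpos.2 (mul_nonneg (deltaQ_pos n ha).le dist_nonneg))))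

/-- `κ` times a bounded sequence is summable. [folklore] -/
theorem summable_kappa_mul {n : ℕ} {a : ℝ} (ha : 0 < a) {g : X d → ℝ} {C : ℝ} (hg : ∀ w, |g w| ≤ C) :
    Summable fun w : X d => kappa n a w * g w := by
  refine (Summable.of_nonneg_of_le (fun _ => abs_nonneg _) (fun w => ?_) ((summable_abs_kappa n ha).mul_right C)).of_abs
  rw [abs_mul]
  exact mul_le_mul_of_nonneg_left (hg w) (abs_nonneg _)

/-- **`κ ∗ (Q'G'Q'*) = δ − a (Q'G'Q'*)`**: `Σ_w κ(w) (Q'G'Q'*)(z − w, 0) = δ_{z,0} − a (Q'G'Q'*)(z, 0)` (the operator identity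
`Δ^{scalar} = (Q'G'Q'*)⁻¹ − a` of node 8 composed with `Q'G'Q'*`). [folklore] -/
theorem tsum_kappa_mul_kerQGQ (n : ℕ) {a : ℝ} (ha : 0 < a) (z : X d) :
    ∑' w : X d, kappa n a w * kerQGQ n a (z - w) 0 = (if z = 0 then 1 else 0) - a * kerQGQ n a z 0 := by
  have hs : ∀ w : X d, kappa n a w * kerQGQ n a (z - w) 0
      = Kinv n a w 0 * kerQGQ n a w z - (if w = 0 then a * kerQGQ n a w z else 0) := by
    intro w
    unfold kappa actionKer
    rw [← kerQGQ_eq_col n ha z w, kerQGQ_symm n ha z w]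
    split_ifs <;> ring
  have S2 : Summable fun w : X d => (if w = 0 then a * kerQGQ n a w z else 0) := by
    apply summable_of_ne_finset_zero (s := {0})
    intro w hw
    rw [Finset.mem_singleton] at hw
    exact if_neg hw
  have S0 : Summable fun w : X d => kappa n a w * kerQGQ n a w z :=
    summable_kappa_mul ha fun w => abs_kerQGQ_le_cQ n ha w z
  have S1 : Summable fun w : X d => Kinv n a w 0 * kerQGQ n a w z := by
    refine (S0.add S2).congr fun w => ?_
    unfold kappa actionKer
    split_ifs <;> ring
  rw [tsum_congr hs, S1.tsum_sub S2, tsum_Kinv_col_mul_kerQGQ n ha z, tsum_eq_single 0 (fun w hw => if_neg hw), if_pos rfl,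
    kerQGQ_symm n ha 0 z]

/-- `0 ≤ symbR ≤ 1/a` on the zone, hence `|symbR| ≤ 1/a`. [folklore] -/
theorem abs_symbR_le (n : ℕ) {a : ℝ} (ha : 0 < a) {q : Fin d → ℝ} (hq : q ∈ BZ d) : |symbR (n + 1) a q| ≤ 1 / a := by
  rw [abs_of_nonneg ((twoGamma0_pos d ha).le.trans (symbR_ge (n + 1) (by omega) ha q hq))]
  exact symbR_le (n + 1) ha q

/-- **The character integrals of `σ · symbR`**: `∫_{[-π,π]^d} σ(q) symbR(q) e^{i q·z} dq = (2π)^d (δ_{z,0} − a (Q'G'Q'*)(z, 0))`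
(termwise integration of the `ℓ¹` series of `σ`, node 2's character integrals of `symbR`, evenness of `κ`, and
`κ ∗ (Q'G'Q'*) = δ − a(Q'G'Q'*)`). [folklore] -/
theorem integral_sigma_symbR_cexp (n : ℕ) {a : ℝ} (ha : 0 < a) (z : X d) :
    ∫ q in BZ d, (sigma n a q : ℂ) * ((symbR (n + 1) a q : ℂ) * cexp (I * B4ContourShift.phase q z))
      = (2 * π : ℂ) ^ d * (((if z = 0 then 1 else 0) - a * kerQGQ n a z 0 : ℝ) : ℂ) := by
  have hN : 1 ≤ n + 1 := by omega
  set F : X d → (Fin d → ℝ) → ℂ := fun w q => (kappa n a w : ℂ) * ((Real.cos (phase q w) : ℂ)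
    * ((symbR (n + 1) a q : ℂ) * cexp (I * B4ContourShift.phase q z))) with hF_def
  have hterm : ∀ q : Fin d → ℝ, (sigma n a q : ℂ) * ((symbR (n + 1) a q : ℂ) * cexp (I * B4ContourShift.phase q z))
      = ∑' w : X d, F w q := by
    intro q
    unfold sigma
    rw [Complex.ofReal_tsum, ← tsum_mul_right]
    refine tsum_congr fun w => ?_
    simp only [hF_def]
    push_cast
    ring
  have hcs : ContinuousOn (fun q : Fin d → ℝ => (symbR (n + 1) a q : ℂ)) (BZ d) :=
    Complex.continuous_ofReal.comp_continuousOn (continuousOn_symbR (n + 1) hN ha)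
  have hse : ∀ w : X d, ContinuousOn (fun q : Fin d → ℝ => (symbR (n + 1) a q : ℂ) * cexp (I * B4ContourShift.phase q w)) (BZ d) :=
    fun w => hcs.mul (continuous_cexp_phase w).continuousOn
  have hint : ∀ w : X d, Integrable (F w) (volume.restrict (BZ d)) := fun w =>
    (continuousOn_const.mul ((Complex.continuous_ofReal.comp (continuous_cos_phase w)).continuousOn.mul (hse z))).integrableOn_compact
      isCompact_BZ
  have hnorm : ∀ w, ∀ q ∈ BZ d, ‖F w q‖ ≤ |kappa n a w| * (1 / a) := by
    intro w q hq
    simp only [hF_def, norm_mul, Complex.norm_real, Real.norm_eq_abs, norm_cexp_phase, mul_one]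
    refine mul_le_mul_of_nonneg_left ?_ (abs_nonneg _)
    calc |Real.cos (phase q w)| * |symbR (n + 1) a q| ≤ 1 * (1 / a) :=
          mul_le_mul (Real.abs_cos_le_one _) (abs_symbR_le n ha hq) (abs_nonneg _) zero_le_one
      _ = 1 / a := one_mul _
  have hsum : Summable fun w : X d => ∫ q in BZ d, ‖F w q‖ := by
    refine Summable.of_nonneg_of_le (fun w => integral_nonneg fun q => norm_nonneg _) (fun w => ?_)
      ((summable_abs_kappa n ha).mul_right (1 / a * (2 * π) ^ d))
    have hmono : ∫ q in BZ d, ‖F w q‖ ≤ ∫ q in BZ d, |kappa n a w| * (1 / a) :=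
      setIntegral_mono_on (hint w).norm (integrableOn_BZ continuous_const) measurableSet_BZ (hnorm w)
    rw [setIntegral_const, volume_real_BZ, smul_eq_mul] at hmono
    calc ∫ q in BZ d, ‖F w q‖ ≤ (2 * π) ^ d * (|kappa n a w| * (1 / a)) := hmono
      _ = |kappa n a w| * (1 / a * (2 * π) ^ d) := by ring
  -- termwise integration
  have hpt : ∀ (w : X d) (q : Fin d → ℝ), (Real.cos (phase q w) : ℂ) * ((symbR (n + 1) a q : ℂ) * cexp (I * B4ContourShift.phase q z))
      = (1 / 2 : ℂ) * ((symbR (n + 1) a q : ℂ) * cexp (I * B4ContourShift.phase q (w + z))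
        + (symbR (n + 1) a q : ℂ) * cexp (I * B4ContourShift.phase q (z - w))) := by
    intro w q
    rw [mul_left_comm, phaseC_eq, phaseC_eq, phaseC_eq, phase_add, phase_sub, ofReal_cos_mul_cexp]
    ring
  have hF_int : ∀ w : X d, ∫ q in BZ d, F w q
      = (((2 * π) ^ d / 2 * (kappa n a w * kerQGQ n a (w + z) 0 + kappa n a w * kerQGQ n a (z - w) 0) : ℝ) : ℂ) := by
    intro w
    simp only [hF_def]
    simp_rw [hpt w]
    rw [integral_const_mul, integral_const_mul, integral_add ((hse (w + z)).integrableOn_compact isCompact_BZ)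
      ((hse (z - w)).integrableOn_compact isCompact_BZ), integral_symbR_mul_cexp n ha, integral_symbR_mul_cexp n ha]
    push_cast
    ring
  simp_rw [hterm]
  rw [← integral_tsum_of_summable_integral_norm hint hsum]
  simp_rw [hF_int]
  rw [← Complex.ofReal_tsum]
  -- the two lattice sums
  have hb1 : ∀ w : X d, |kerQGQ n a (w + z) 0| ≤ cQ d n a := fun w => abs_kerQGQ_le_cQ n ha _ _
  have hb2 : ∀ w : X d, |kerQGQ n a (z - w) 0| ≤ cQ d n a := fun w => abs_kerQGQ_le_cQ n ha _ _
  have hre : ∑' w : X d, kappa n a w * kerQGQ n a (w + z) 0 = ∑' w : X d, kappa n a w * kerQGQ n a (z - w) 0 := by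
    calc ∑' w : X d, kappa n a w * kerQGQ n a (w + z) 0
        = ∑' w : X d, (fun w => kappa n a w * kerQGQ n a (w + z) 0) ((Equiv.neg (X d)) w) :=
          ((Equiv.neg (X d)).tsum_eq _).symm
      _ = ∑' w : X d, kappa n a w * kerQGQ n a (z - w) 0 :=
          tsum_congr fun w => by simp only [Equiv.neg_apply, kappa_even n ha, neg_add_eq_sub]
  rw [tsum_mul_left, (summable_kappa_mul ha hb1).tsum_add (summable_kappa_mul ha hb2), hre, tsum_kappa_mul_kerQGQ n ha z]
  push_cast
  ring

/-- **The character integrals of `1 − a·symbR`**: `∫ (1 − a symbR(q)) e^{i q·z} dq = (2π)^d (δ_{z,0} − a (Q'G'Q'*)(z, 0))`. [folklore] -/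
theorem integral_one_sub_symbR_cexp (n : ℕ) {a : ℝ} (ha : 0 < a) (z : X d) :
    ∫ q in BZ d, ((1 : ℂ) - a * symbR (n + 1) a q) * cexp (I * B4ContourShift.phase q z)
      = (2 * π : ℂ) ^ d * (((if z = 0 then 1 else 0) - a * kerQGQ n a z 0 : ℝ) : ℂ) := by
  have hN : 1 ≤ n + 1 := by omega
  have hF : ∫ q in BZ d, cexp (I * B4ContourShift.phase q z) = if z = 0 then (2 * π : ℂ) ^ d else 0 := by
    have h := fourierBox_one (d := d) z
    unfold fourierBox integrand at h
    simpa only [one_mul] using h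
  have hcs : ContinuousOn (fun q : Fin d → ℝ => (symbR (n + 1) a q : ℂ)) (BZ d) :=
    Complex.continuous_ofReal.comp_continuousOn (continuousOn_symbR (n + 1) hN ha)
  have hi2 : IntegrableOn (fun q : Fin d → ℝ => (symbR (n + 1) a q : ℂ) * cexp (I * B4ContourShift.phase q z)) (BZ d) :=
    (hcs.mul (continuous_cexp_phase z).continuousOn).integrableOn_compact isCompact_BZ
  simp_rw [sub_mul, one_mul, mul_assoc]
  rw [integral_sub (integrableOn_BZ' (continuous_cexp_phase z)) (hi2.const_mul _), integral_const_mul, hF,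
    integral_symbR_mul_cexp n ha]
  split_ifs <;> push_cast <;> ring

/-- **`σ(p)·symbR(p) = 1 − a·symbR(p)` on the zone** — the symbol of `Δ^{scalar}·(Q'G'Q'*) = I − a(Q'G'Q'*)`; both sides are
continuous on `[-π,π]^d` with the same character integrals (Fourier uniqueness §1). [folklore] -/
theorem sigma_mul_symbR (n : ℕ) {a : ℝ} (ha : 0 < a) {p : Fin d → ℝ} (hp : p ∈ BZ d) :
    sigma n a p * symbR (n + 1) a p = 1 - a * symbR (n + 1) a p := by
  have hN : 1 ≤ n + 1 := by omega
  have hcs : ContinuousOn (fun q : Fin d → ℝ => (symbR (n + 1) a q : ℂ)) (BZ d) :=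
    Complex.continuous_ofReal.comp_continuousOn (continuousOn_symbR (n + 1) hN ha)
  have hcσ : Continuous fun q : Fin d → ℝ => (sigma n a q : ℂ) := Complex.continuous_ofReal.comp (continuous_sigma n ha)
  have h := eqOn_zero_of_integral_cexp (d := d)
    (h := fun q => (sigma n a q : ℂ) * (symbR (n + 1) a q : ℂ) - ((1 : ℂ) - a * symbR (n + 1) a q))
    ((hcσ.continuousOn.mul hcs).sub (continuousOn_const.sub (continuousOn_const.mul hcs))) ?_ hp
  · have h' : (sigma n a p : ℂ) * (symbR (n + 1) a p : ℂ) = (1 : ℂ) - a * symbR (n + 1) a p := by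
      simpa [sub_eq_zero] using h
    exact_mod_cast h'
  · intro z
    have hi1 : IntegrableOn (fun q : Fin d → ℝ => (sigma n a q : ℂ) * ((symbR (n + 1) a q : ℂ) * cexp (I * B4ContourShift.phase q z)))
        (BZ d) := (hcσ.continuousOn.mul (hcs.mul (continuous_cexp_phase z).continuousOn)).integrableOn_compact isCompact_BZ
    have hi2 : IntegrableOn (fun q : Fin d → ℝ => ((1 : ℂ) - a * symbR (n + 1) a q) * cexp (I * B4ContourShift.phase q z)) (BZ d) :=
      ((continuousOn_const.sub (continuousOn_const.mul hcs)).mul (continuous_cexp_phase z).continuousOn).integrableOn_compact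
        isCompact_BZ
    have hpt : ∀ q : Fin d → ℝ, ((sigma n a q : ℂ) * (symbR (n + 1) a q : ℂ) - ((1 : ℂ) - a * symbR (n + 1) a q))
        * cexp (I * B4ContourShift.phase q z) = (sigma n a q : ℂ) * ((symbR (n + 1) a q : ℂ) * cexp (I * B4ContourShift.phase q z))
          - ((1 : ℂ) - a * symbR (n + 1) a q) * cexp (I * B4ContourShift.phase q z) := fun q => by ring
    simp only [hpt]
    rw [integral_sub hi1 hi2, integral_sigma_symbR_cexp n ha, integral_one_sub_symbR_cexp n ha, sub_self]

/-- **B5 (1.66), scalar `ℤ^d` — THE SYMBOL OF THE COARSE ACTION IN CLOSED FORM**: on the zone,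
`σ(p) = 1/symbR(p) − a`, i.e. the symbol of `Δ^{scalar} = (Q'G'Q'*)⁻¹ − a` is the reciprocal of the printed (2.75)
multiplier minus `a`. [cite: Balaban1984PropagatorsI, (1.65)-(1.66) p.29] -/
theorem sigma_eq_inv_symbR_sub (n : ℕ) {a : ℝ} (ha : 0 < a) {p : Fin d → ℝ} (hp : p ∈ BZ d) :
    sigma n a p = 1 / symbR (n + 1) a p - a := by
  have hpos : 0 < symbR (n + 1) a p := (twoGamma0_pos d ha).trans_le (symbR_ge (n + 1) (by omega) ha p hp)
  have h := sigma_mul_symbR n ha hp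
  field_simp
  linarith [h]

/-- **… and in PRINTED-TYPE closed form**: `σ(p) = Δ(p) / X(p)`, `X(p) = Σ_k |u(p + l_k)|² R_k(p)`, `R_0 = 1`,
`R_k = Δ(p)/Δ(p + l_k)` — i.e. `σ(p) = [Σ_{l} |u(p+l)|²/Δ(p+l)]⁻¹`, the classical block-averaging multiplier — manifestly
`a`-free, consistent with node 8's `B5Hk165ActionZd.actionKer_indep`. [cite: Balaban1984PropagatorsII, (2.75) p.236] -/
theorem sigma_eq_closed (n : ℕ) {a : ℝ} (ha : 0 < a) {p : Fin d → ℝ} (hp : p ∈ BZ d) :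
    sigma n a p = DeltaXir (n + 1) 0 p / Xr (n + 1) p := by
  have hπ : ∀ μ, |p μ| ≤ π := fun μ => abs_le.2 ⟨hp.1 μ, hp.2 μ⟩
  have hX : 0 < Xr (n + 1) p := lt_of_lt_of_le (by positivity) (Xr_ge (n + 1) (by omega) p hπ)
  have hD : 0 ≤ DeltaXir (n + 1) 0 p := DeltaXir_nonneg (n + 1) 0 le_rfl p
  have hE : 0 < a * Xr (n + 1) p + DeltaXir (n + 1) 0 p := by positivity
  rw [sigma_eq_inv_symbR_sub n ha hp]
  unfold symbR
  field_simp
  ring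

end Sigma

end

end Literature.MathematicalPhysics.QuantumFieldTheory.Balaban1983to89.B6QGQSymbol275Zd
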